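import Summits.MatrixMultiplication.OmegaCensus.DominoZ31StructFiveRowsA
import HarnessLib

/-!
# Structural part-`5` route at `p = 31`: rows `6`–`13` of the completeness check (file 2 of 4)

See `DominoZ31StructFiveRowsA.lean` (split rationale) and `DominoZ31Z31StructFiveCells.lean` (the cell theorems).  ω-census `pub-omega`, family (b3), seat
pub-omega-group gen 23; framing: lottery ticket, floor = certified bounds/negative ranges; NOT progress on ω.
-/

namespace Summit.MatrixMultiplication.OmegaCensus

open Finset ZpZpDomino Literature.Combinatorics.Additive

namespace ZpZpDomino

set_option maxHeartbeats 4000000 in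
/-- Row `b = 6` of the completeness check (`31²` lookups). [folklore] -/
theorem checkFiveRow_31_6 : checkFiveRow 31 ecZ31s5 tabTreeZ31s5 6 = true := by decide +kernel

set_option maxHeartbeats 4000000 in
/-- Row `b = 7` of the completeness check (`31²` lookups). [folklore] -/
theorem checkFiveRow_31_7 : checkFiveRow 31 ecZ31s5 tabTreeZ31s5 7 = true := by decide +kernel

set_option maxHeartbeats 4000000 in
/-- Row `b = 8` of the completeness check (`31²` lookups). [folklore] -/
theorem checkFiveRow_31_8 : checkFiveRow 31 ecZ31s5 tabTreeZ31s5 8 = true := by decide +kernel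

set_option maxHeartbeats 4000000 in
/-- Row `b = 9` of the completeness check (`31²` lookups). [folklore] -/
theorem checkFiveRow_31_9 : checkFiveRow 31 ecZ31s5 tabTreeZ31s5 9 = true := by decide +kernel

set_option maxHeartbeats 4000000 in
/-- Row `b = 10` of the completeness check (`31²` lookups). [folklore] -/
theorem checkFiveRow_31_10 : checkFiveRow 31 ecZ31s5 tabTreeZ31s5 10 = true := by decide +kernel

set_option maxHeartbeats 4000000 in
/-- Row `b = 11` of the completeness check (`31²` lookups). [folklore] -/
theorem checkFiveRow_31_11 : checkFiveRow 31 ecZ31s5 tabTreeZ31s5 11 = true := by decide +kernel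

set_option maxHeartbeats 4000000 in
/-- Row `b = 12` of the completeness check (`31²` lookups). [folklore] -/
theorem checkFiveRow_31_12 : checkFiveRow 31 ecZ31s5 tabTreeZ31s5 12 = true := by decide +kernel

set_option maxHeartbeats 4000000 in
/-- Row `b = 13` of the completeness check (`31²` lookups). [folklore] -/
theorem checkFiveRow_31_13 : checkFiveRow 31 ecZ31s5 tabTreeZ31s5 13 = true := by decide +kernel


end ZpZpDomino

end Summit.MatrixMultiplication.OmegaCensus
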